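import Mathlib
import Summits.NavierStokesRegularity.NavierStokesRegularity.Theorems.FilamentSkeletonRssTangentSkeletonNearStraightLSwirlBandGradient

/-!
# Swirl-band decoupling, ODD kernel-gradient entry and the `k = 0` masses
# (`TangentSkeletonNearStraightL`, stmt-NavierStokesRegularity-23320; completes the partner-symbol package of (R♯-sw))

Last pieces of the partner-block symbol matrix (crux strategist's (R♯-sw), `Cruxes/SkeletonJ1L/STRATEGY-CENSUS.md` PART III §D5), in the
tree's vocabulary `Numerics.Cint p = 2√pK₁(2√p)`; def-free:

* `integral_inv_rpow_three_halves_mass`, `integral_inv_rpow_five_halves_mass` : the `k = 0` values `∫_ℝ(σ²+D²)^{−3/2} = 2/D²`,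
  `∫_ℝ(σ²+D²)^{−5/2} = 4/(3D⁴)` — the `L¹` masses of the partner kernels, i.e. the Young/Schur scale `γ/(2πd̂²)` of the coupling block
  that the strategist's numerics report as the Γ-independent `‖B‖₂ ≈ 17.5`;
* `integral_mul_sin_mul_inv_rpow_five_halves` : `∫₀^∞ h sin(xh)(1+h²)^{−5/2} dh = (x/3)·Cint(x²/4)` (`= x²K₁(x)/3`; Γ(5/2)-subordination,
  Fubini on `(0,∞)²`, odd Gaussian moment) and the bound `(x/3)(1+x)e^{−x}` (`Cint_le_sharp`, p825980);
* `swirlBand_decoupling_grad_odd` : for `0 < μ ≤ d`, `k ≥ 0`, `D = √(d²+μ²)`: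
  `|∫₀^∞ σ sin(kσ)((d²+σ²)+μ²)^{−5/2} dσ| ≤ D⁻³·(kD/3)(1+kD)e^{−kD}`.

Package (p825993, p825980, p826065, p826156, p826228, this file): every entry of the partner block's arclength symbol — kernel
`((d²+σ²)+μ²)^{−3/2}` and its first gradient, weights `1, σ, σ²` — is `≤ poly(kD)·e^{−kD}`; in the swirl band `k ≥ μ⁻¹`, `d ≥ ρ√Γ` the
inter-filament coupling is `O(e^{−ρ√Γ/μ})`.
HONEST FRAMING: MODEL-level lemmas of the linear theory of a HYPOTHETICAL filament skeleton on the NEGATIVE side of a MODEL route; no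
registered stub of 23320 is proved; nothing here bears on Navier–Stokes regularity or blow-up.  `--supports stmt-NavierStokesRegularity-23320`.
-/

set_option linter.dupNamespace false

noncomputable section

open Real Set MeasureTheory Filter Topology

namespace Summit.NavierStokesRegularity.NavierStokesRegularity.Theorems.TangentSkeletonNearStraightLSwirlBand

open Summit.NavierStokesRegularity.NavierStokesRegularity.Theorems.AnalyticStripLiaSymbol
open Summit.NavierStokesRegularity.NavierStokesRegularity.Theorems.AnalyticStripLiaSymbol.Numerics

/-! ## §1  The `k = 0` masses (L¹ norms of the partner kernels): `2/D²` and `4/(3D⁴)` -/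

/-- `∫_ℝ (σ²+D²)^{−3/2} dσ = 2/D²` — the `L¹` mass of the partner kernel (Young/Schur scale of the coupling block,
the strategist's `γ/(2πd̂²)`). [folklore] -/
theorem integral_inv_rpow_three_halves_mass {D : ℝ} (hD : 0 < D) :
    ∫ σ : ℝ, ((σ ^ 2 + D ^ 2) ^ (3 / 2 : ℝ))⁻¹ = 2 / D ^ 2 := by
  have h := integral_cos_mul_inv_rpow_three_halves_scale hD 0
  simp only [zero_mul, Real.cos_zero, one_mul, ne_eq, OfNat.ofNat_ne_zero, not_false_eq_true, zero_pow,
    zero_div, Cint_zero, mul_one] at h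
  exact h

/-- `∫_ℝ (σ²+D²)^{−5/2} dσ = 4/(3D⁴)` — the `L¹` mass of the kernel-gradient power. [folklore] -/
theorem integral_inv_rpow_five_halves_mass {D : ℝ} (hD : 0 < D) :
    ∫ σ : ℝ, ((σ ^ 2 + D ^ 2) ^ (5 / 2 : ℝ))⁻¹ = 4 / (3 * D ^ 4) := by
  -- scale the `x = 0` case of the order-5/2 transform
  have hsub := MeasureTheory.Measure.integral_comp_mul_left (fun σ : ℝ => ((σ ^ 2 + D ^ 2) ^ (5 / 2 : ℝ))⁻¹) D
  have hD0 : D ≠ 0 := hD.ne'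
  rw [abs_of_pos (inv_pos.mpr hD), smul_eq_mul] at hsub
  have hg : ∀ h : ℝ, (((D * h) ^ 2 + D ^ 2) ^ (5 / 2 : ℝ))⁻¹ = (D ^ 5)⁻¹ * ((1 + h ^ 2) ^ (5 / 2 : ℝ))⁻¹ := by
    intro h; rw [rpow_scale5 hD h, mul_inv]
  simp_rw [hg] at hsub
  rw [integral_const_mul] at hsub
  have h0 := integral_cos_mul_inv_rpow_five_halves 0
  have h0' : ∫ h : ℝ, ((1 + h ^ 2) ^ (5 / 2 : ℝ))⁻¹ = 4 / 3 := by
    have hz : ∫ t in Ioi (0:ℝ), t * (Real.exp (-t) * Real.exp (-(((0:ℝ) ^ 2 / 4) / t))) = 1 := by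
      have : ∀ t ∈ Ioi (0:ℝ), t * (Real.exp (-t) * Real.exp (-(((0:ℝ) ^ 2 / 4) / t))) = t * Real.exp (-t) := by
        intro t _; simp
      rw [setIntegral_congr_fun measurableSet_Ioi this, integral_Ioi_mul_exp_neg]
    simp only [zero_mul, Real.cos_zero, one_mul] at h0
    rw [h0, hz]; norm_num
  rw [h0'] at hsub
  set G := ∫ σ : ℝ, ((σ ^ 2 + D ^ 2) ^ (5 / 2 : ℝ))⁻¹ with hG
  have : G = D * ((D ^ 5)⁻¹ * (4 / 3)) := by rw [hsub]; field_simp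
  rw [this]; field_simp


/-! ## §2  The odd order-`5/2` transform `∫₀^∞ h·sin(xh)(1+h²)^{−5/2} dh = (x/3)·C(x²/4)` (`= (x/3)·xK₁(x)`) -/

/-- Continuity of the order-`5/2` subordinated odd integrand. [folklore] -/
theorem continuous_sinSubordinand5 (x : ℝ) : Continuous (fun p : ℝ × ℝ => p.1 * Real.sin (x * p.1)
    * ((Real.Gamma (5 / 2))⁻¹ * (p.2 ^ (3 / 2 : ℝ) * Real.exp (-((1 + p.1 ^ 2) * p.2))))) := by
  have hr : Continuous fun p : ℝ × ℝ => p.2 ^ (3 / 2 : ℝ) :=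
    (Real.continuous_rpow_const (by norm_num)).comp continuous_snd
  fun_prop

/-- `h·(1+h²)^{−5/2} ≤ (1+h²)⁻¹` for `h ≥ 0`. [folklore] -/
theorem mul_inv_rpow5_le {h : ℝ} (hh : 0 ≤ h) : h * ((1 + h ^ 2) ^ (5 / 2 : ℝ))⁻¹ ≤ (1 + h ^ 2)⁻¹ := by
  have hpos : 0 < 1 + h ^ 2 := by positivity
  have h1 : 1 ≤ 1 + h ^ 2 := by nlinarith
  have hpow : (1 + h ^ 2) ^ (3 / 2 : ℝ) ≤ (1 + h ^ 2) ^ (5 / 2 : ℝ) :=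
    Real.rpow_le_rpow_of_exponent_le h1 (by norm_num)
  have hinv : ((1 + h ^ 2) ^ (5 / 2 : ℝ))⁻¹ ≤ ((1 + h ^ 2) ^ (3 / 2 : ℝ))⁻¹ :=
    inv_anti₀ (Real.rpow_pos_of_pos hpos _) hpow
  calc h * ((1 + h ^ 2) ^ (5 / 2 : ℝ))⁻¹ ≤ h * ((1 + h ^ 2) ^ (3 / 2 : ℝ))⁻¹ := by gcongr
    _ ≤ (1 + h ^ 2)⁻¹ := mul_inv_rpow_le hh

/-- Integrability of the order-`5/2` subordinated odd integrand on `(0,∞) × (0,∞)`. [folklore] -/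
theorem integrable_sinSubordinand5 (x : ℝ) :
    Integrable (fun p : ℝ × ℝ => p.1 * Real.sin (x * p.1)
      * ((Real.Gamma (5 / 2))⁻¹ * (p.2 ^ (3 / 2 : ℝ) * Real.exp (-((1 + p.1 ^ 2) * p.2)))))
      ((volume.restrict (Ioi (0:ℝ))).prod (volume.restrict (Ioi (0:ℝ)))) := by
  have hmeas : AEStronglyMeasurable (fun p : ℝ × ℝ => p.1 * Real.sin (x * p.1)
      * ((Real.Gamma (5 / 2))⁻¹ * (p.2 ^ (3 / 2 : ℝ) * Real.exp (-((1 + p.1 ^ 2) * p.2)))))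
      ((volume.restrict (Ioi (0:ℝ))).prod (volume.restrict (Ioi (0:ℝ)))) :=
    (continuous_sinSubordinand5 x).aestronglyMeasurable
  rw [integrable_prod_iff hmeas]
  constructor
  · refine Filter.Eventually.of_forall fun h => ?_
    exact ((integrableOn_rpow_three_halves_mul_exp h).const_mul ((Real.Gamma (5 / 2))⁻¹)).const_mul (h * Real.sin (x * h))
  · have hnorm : ∀ h : ℝ, ∫ t in Ioi (0:ℝ), ‖(fun p : ℝ × ℝ => p.1 * Real.sin (x * p.1)
      * ((Real.Gamma (5 / 2))⁻¹ * (p.2 ^ (3 / 2 : ℝ) * Real.exp (-((1 + p.1 ^ 2) * p.2))))) (h, t)‖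
        = |h * Real.sin (x * h)| * ((1 + h ^ 2) ^ (5 / 2 : ℝ))⁻¹ := by
      intro h
      have hG : 0 < (Real.Gamma (5 / 2))⁻¹ := inv_pos.mpr (Real.Gamma_pos_of_pos (by norm_num))
      have hpt : ∀ t ∈ Ioi (0:ℝ), ‖(fun p : ℝ × ℝ => p.1 * Real.sin (x * p.1)
          * ((Real.Gamma (5 / 2))⁻¹ * (p.2 ^ (3 / 2 : ℝ) * Real.exp (-((1 + p.1 ^ 2) * p.2))))) (h, t)‖
            = |h * Real.sin (x * h)| * ((Real.Gamma (5 / 2))⁻¹ * (t ^ (3 / 2 : ℝ) * Real.exp (-((1 + h ^ 2) * t)))) := by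
        intro t ht
        simp only [Real.norm_eq_abs, abs_mul]
        rw [abs_of_pos hG, abs_of_nonneg (Real.rpow_nonneg (le_of_lt ht) _), abs_of_pos (Real.exp_pos _)]
      rw [setIntegral_congr_fun measurableSet_Ioi hpt, integral_const_mul, integral_const_mul,
        inv_rpow_five_halves_eq_integral h]
    simp_rw [hnorm]
    have hdom : Integrable (fun h : ℝ => (1 + h ^ 2)⁻¹) (volume.restrict (Ioi (0:ℝ))) :=
      integrable_inv_one_add_sq.integrableOn
    refine hdom.mono' ?_ ?_
    · refine ((Continuous.abs ?_).mul ?_).aestronglyMeasurable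
      · exact continuous_id.mul (Real.continuous_sin.comp (continuous_const.mul continuous_id))
      · refine Continuous.inv₀ ?_ (fun h => (Real.rpow_pos_of_pos (by positivity) _).ne')
        exact (continuous_const.add (continuous_pow 2)).rpow_const fun _ => Or.inr (by norm_num)
    · rw [ae_restrict_iff' measurableSet_Ioi]
      refine Filter.Eventually.of_forall fun h (hh : 0 < h) => ?_
      rw [Real.norm_eq_abs, abs_mul, abs_abs,
        abs_of_pos (inv_pos.mpr (Real.rpow_pos_of_pos (by positivity) _)), abs_mul, abs_of_pos hh]
      calc h * |Real.sin (x * h)| * ((1 + h ^ 2) ^ (5 / 2 : ℝ))⁻¹ ≤ h * 1 * ((1 + h ^ 2) ^ (5 / 2 : ℝ))⁻¹ := by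
            gcongr; exact Real.abs_sin_le_one _
        _ ≤ (1 + h ^ 2)⁻¹ := by rw [mul_one]; exact mul_inv_rpow5_le hh.le

/-- For `t > 0`: `Γ(5/2)⁻¹·t^{3/2}e^{−t}·(x/(4t))√(π/t)e^{−x²/(4t)} = (x/3)·e^{−t}e^{−(x²/4)/t}`. [folklore] -/
theorem subordination_weight5_odd_eq {t : ℝ} (ht : 0 < t) (x : ℝ) :
    (Real.Gamma (5 / 2))⁻¹ * (t ^ (3 / 2 : ℝ) * Real.exp (-t)) * (x / (4 * t) * √(π / t) * Real.exp (-x ^ 2 / (4 * t)))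
      = x / 3 * (Real.exp (-t) * Real.exp (-((x ^ 2 / 4) / t))) := by
  rw [Gamma_five_halves]
  have h32 : t ^ (3 / 2 : ℝ) = t * √t := by
    rw [show (3 / 2 : ℝ) = 1 + 1 / 2 by norm_num, Real.rpow_add ht, Real.rpow_one, Real.sqrt_eq_rpow]
  have hpi : 0 < π := Real.pi_pos
  have h1 : √(π / t) = √π / √t := Real.sqrt_div (le_of_lt hpi) t
  have hst : 0 < √t := Real.sqrt_pos.mpr ht
  have hsp : 0 < √π := Real.sqrt_pos.mpr hpi
  have hx : -x ^ 2 / (4 * t) = -((x ^ 2 / 4) / t) := by field_simp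
  rw [h32, h1, hx]
  field_simp

/-- **Odd transform of `(1+h²)^{-5/2}`**: `∫₀^∞ h·sin(xh)(1+h²)^{−5/2} dh = (x/3)·C(x²/4)` (`= x²K₁(x)/3`; equivalently one
integration by parts from the order-3/2 cosine transform). [folklore] -/
theorem integral_mul_sin_mul_inv_rpow_five_halves (x : ℝ) :
    ∫ h in Ioi (0:ℝ), h * Real.sin (x * h) * ((1 + h ^ 2) ^ (5 / 2 : ℝ))⁻¹ = x / 3 * Cint (x ^ 2 / 4) := by
  have hL : ∫ h in Ioi (0:ℝ), h * Real.sin (x * h) * ((1 + h ^ 2) ^ (5 / 2 : ℝ))⁻¹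
      = ∫ h in Ioi (0:ℝ), ∫ t in Ioi (0:ℝ), (fun p : ℝ × ℝ => p.1 * Real.sin (x * p.1)
          * ((Real.Gamma (5 / 2))⁻¹ * (p.2 ^ (3 / 2 : ℝ) * Real.exp (-((1 + p.1 ^ 2) * p.2))))) (h, t) := by
    refine integral_congr_ae (Filter.Eventually.of_forall fun h => ?_)
    simp only []
    rw [integral_const_mul, integral_const_mul, inv_rpow_five_halves_eq_integral h]
  have hint : Integrable (Function.uncurry fun h t => (fun p : ℝ × ℝ => p.1 * Real.sin (x * p.1)
      * ((Real.Gamma (5 / 2))⁻¹ * (p.2 ^ (3 / 2 : ℝ) * Real.exp (-((1 + p.1 ^ 2) * p.2))))) (h, t))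
      ((volume.restrict (Ioi (0:ℝ))).prod (volume.restrict (Ioi (0:ℝ)))) := integrable_sinSubordinand5 x
  have hswap := integral_integral_swap hint
  rw [hL, hswap]
  have hinner : ∀ t ∈ Ioi (0:ℝ), (∫ h in Ioi (0:ℝ), (fun p : ℝ × ℝ => p.1 * Real.sin (x * p.1)
      * ((Real.Gamma (5 / 2))⁻¹ * (p.2 ^ (3 / 2 : ℝ) * Real.exp (-((1 + p.1 ^ 2) * p.2))))) (h, t))
        = x / 3 * (Real.exp (-t) * Real.exp (-((x ^ 2 / 4) / t))) := by
    intro t ht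
    have ht : (0:ℝ) < t := ht
    have hrw : ∀ h : ℝ, (fun p : ℝ × ℝ => p.1 * Real.sin (x * p.1)
        * ((Real.Gamma (5 / 2))⁻¹ * (p.2 ^ (3 / 2 : ℝ) * Real.exp (-((1 + p.1 ^ 2) * p.2))))) (h, t)
          = ((Real.Gamma (5 / 2))⁻¹ * (t ^ (3 / 2 : ℝ) * Real.exp (-t)))
            * (h * Real.sin (x * h) * Real.exp (-t * h ^ 2)) := by
      intro h
      simp only []
      have : Real.exp (-((1 + h ^ 2) * t)) = Real.exp (-t) * Real.exp (-t * h ^ 2) := by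
        rw [← Real.exp_add]; congr 1; ring
      rw [this]; ring
    simp_rw [hrw]
    rw [integral_const_mul, integral_Ioi_mul_sin_mul_gauss ht x, subordination_weight5_odd_eq ht x]
  rw [setIntegral_congr_fun measurableSet_Ioi hinner, integral_const_mul]
  rfl

/-! ## §3  Bound and scaled census-style statement for the odd kernel-gradient entry -/

/-- `|∫₀^∞ h·sin(xh)(1+h²)^{−5/2} dh| ≤ (x/3)(1+x)e^{−x}` for `x ≥ 0`. [folklore] -/
theorem abs_integral_mul_sin_mul_inv_rpow_five_halves_le {x : ℝ} (hx : 0 ≤ x) :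
    |∫ h in Ioi (0:ℝ), h * Real.sin (x * h) * ((1 + h ^ 2) ^ (5 / 2 : ℝ))⁻¹| ≤ x / 3 * (1 + x) * Real.exp (-x) := by
  rw [integral_mul_sin_mul_inv_rpow_five_halves x]
  have hp : 0 ≤ x ^ 2 / 4 := by positivity
  have hroot : √(x ^ 2 / 4) = x / 2 := by
    rw [show x ^ 2 / 4 = (x / 2) ^ 2 by ring]; exact Real.sqrt_sq (by linarith)
  have h2 := Cint_le_sharp hp
  rw [hroot] at h2
  rw [abs_of_nonneg (mul_nonneg (by linarith) (Cint_nonneg _))]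
  calc x / 3 * Cint (x ^ 2 / 4) ≤ x / 3 * ((1 + 2 * (x / 2)) * Real.exp (-(2 * (x / 2)))) :=
        mul_le_mul_of_nonneg_left h2 (by linarith)
    _ = x / 3 * (1 + x) * Real.exp (-x) := by ring_nf

/-- **Scaled odd order-`5/2` symbol**: for `D > 0`, `k ≥ 0`,
`|∫₀^∞ σ·sin(kσ)(σ²+D²)^{−5/2} dσ| ≤ D⁻³·(kD/3)(1+kD)e^{−kD}`. [folklore] -/
theorem abs_integral_mul_sin_mul_inv_rpow_five_halves_scale_le {D k : ℝ} (hD : 0 < D) (hk : 0 ≤ k) :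
    |∫ σ in Ioi (0:ℝ), σ * Real.sin (k * σ) * ((σ ^ 2 + D ^ 2) ^ (5 / 2 : ℝ))⁻¹|
      ≤ (D ^ 3)⁻¹ * (k * D / 3 * (1 + k * D) * Real.exp (-(k * D))) := by
  have hsub := integral_comp_mul_left_Ioi
    (fun σ : ℝ => σ * Real.sin (k * σ) * ((σ ^ 2 + D ^ 2) ^ (5 / 2 : ℝ))⁻¹) 0 hD
  rw [mul_zero, smul_eq_mul] at hsub
  have hD0 : D ≠ 0 := hD.ne'
  have hg : ∀ h : ℝ, (D * h) * Real.sin (k * (D * h)) * (((D * h) ^ 2 + D ^ 2) ^ (5 / 2 : ℝ))⁻¹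
      = (D ^ 4)⁻¹ * (h * Real.sin ((k * D) * h) * ((1 + h ^ 2) ^ (5 / 2 : ℝ))⁻¹) := by
    intro h
    rw [rpow_scale5 hD h, mul_inv, show k * (D * h) = (k * D) * h by ring]
    field_simp
  simp_rw [hg] at hsub
  rw [integral_const_mul] at hsub
  set A := ∫ h in Ioi (0:ℝ), h * Real.sin ((k * D) * h) * ((1 + h ^ 2) ^ (5 / 2 : ℝ))⁻¹ with hA
  set G := ∫ σ in Ioi (0:ℝ), σ * Real.sin (k * σ) * ((σ ^ 2 + D ^ 2) ^ (5 / 2 : ℝ))⁻¹ with hG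
  have hGA : G = (D ^ 3)⁻¹ * A := by
    have h' : G = D * ((D ^ 4)⁻¹ * A) := by rw [hsub]; field_simp
    rw [h']; field_simp
  rw [hGA, abs_mul, abs_of_pos (by positivity : (0:ℝ) < (D ^ 3)⁻¹)]
  exact mul_le_mul_of_nonneg_left (abs_integral_mul_sin_mul_inv_rpow_five_halves_le (by positivity))
    (by positivity)

/-- **(R♯-sw), odd kernel-gradient entry** (census notation): for `0 < μ ≤ d`, `k ≥ 0`, `D = √(d²+μ²)`,
`|∫₀^∞ σ sin(kσ)((d²+σ²)+μ²)^{−5/2} dσ| ≤ D⁻³·(kD/3)(1+kD)e^{−kD}`. [folklore] -/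
theorem swirlBand_decoupling_grad_odd : ∀ (d μ k : ℝ), 0 < μ → μ ≤ d → 0 ≤ k →
    |∫ σ in Ioi (0:ℝ), σ * Real.sin (k * σ) * ((d ^ 2 + σ ^ 2) + μ ^ 2) ^ (-(5:ℝ) / 2)|
      ≤ (√(d ^ 2 + μ ^ 2) ^ 3)⁻¹ * (k * √(d ^ 2 + μ ^ 2) / 3 * (1 + k * √(d ^ 2 + μ ^ 2))
        * Real.exp (-k * √(d ^ 2 + μ ^ 2))) := by
  intro d μ k hμ _ hk
  have hD2 : 0 < d ^ 2 + μ ^ 2 := by positivity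
  have hD : 0 < √(d ^ 2 + μ ^ 2) := Real.sqrt_pos.mpr hD2
  have hsq : √(d ^ 2 + μ ^ 2) ^ 2 = d ^ 2 + μ ^ 2 := Real.sq_sqrt hD2.le
  have hfun : ∀ σ ∈ Ioi (0:ℝ), σ * Real.sin (k * σ) * ((d ^ 2 + σ ^ 2) + μ ^ 2) ^ (-(5:ℝ) / 2)
      = σ * Real.sin (k * σ) * ((σ ^ 2 + √(d ^ 2 + μ ^ 2) ^ 2) ^ (5 / 2 : ℝ))⁻¹ := by
    intro σ _
    rw [hsq, show (d ^ 2 + σ ^ 2) + μ ^ 2 = σ ^ 2 + (d ^ 2 + μ ^ 2) by ring,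
      show (-(5:ℝ) / 2) = -(5 / 2 : ℝ) by norm_num, Real.rpow_neg (by positivity)]
  rw [setIntegral_congr_fun measurableSet_Ioi hfun, neg_mul]
  exact abs_integral_mul_sin_mul_inv_rpow_five_halves_scale_le hD hk

end Summit.NavierStokesRegularity.NavierStokesRegularity.Theorems.TangentSkeletonNearStraightLSwirlBand
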